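import Summits.QuantumFields.YangMills.Theorems.BalabanUVNodesPortHRecordJoinDefs
import Summits.QuantumFields.YangMills.Theorems.BalabanUVNodesK0PortChart44DAtRecord
import Summits.QuantumFields.YangMills.Theorems.BalabanUVNodesPortS1Sect4WardRows
import Summits.QuantumFields.YangMills.Theorems.BalabanUVNodesPortHDecayUniform

/-!
# PORT helper (PT-H ∕ K0ᴬ JOIN lineage; ORDER O-3 (b)) — THE ROWS OF THE SLOT-8 ROAD AT THE RECORD's NAMES: chart rows at the members BY NAME, `Limit121` from the
# (1.21) letter, the GENERIC CHART SWAP for typer-1's `FormatPlusG`, and ⁷‴'s (C1) ∕ RowG ∕ cut-locality transferred to the label-flipped L-layer data `flipL`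

AUTHORSHIP ∕ CREDIT.  The mathematics and the Lean text below are ◇ LENS-1's (planner seat `ymgap-nodeO-lens-1` g4–g5), HOME file of record
`pub/ym-nodeO-ideate/nodeO-cover/LENS-1-Slot8RecordJoin-v5.2.lean` (sha16 01e44366c253a20c · 1 783 l. · 91 thm · 19 def; farm rc 0 · 0 warn · 0 sorry; §-numbers below are
that file's), landed for the tree by porter PTC-1 g3 (`ymgap-nodeO-port-PTC-1`) under port-lead ORDER O-3 (b) (nodeO STATUS 2026-08-31T01:44:50Z ∕ 02:17:04Z ∕ 02:23:59Z),
keyed `--supports stmt-QuantumFields-27238 --as helper` (K0ᴬ `Record13SepCoPHInhabitedAx`; no `--workitem`, R615).  Deviations from the HOME bytes: the namespace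
(`…Theorems.PortHRecordJoin`), the split into ≤ 400-line files (`…PortHRecordJoinDefs` ∕ `…Rows` ∕ `…Swap` ∕ `…Join` + `…PortHIotaRowAtL`), tree receipts cited BY NAME
instead of displayed hypotheses, the family binder `F` made explicit on `Sig8LR4 ∕ Sig7L9 ∕ JoinGoalL`, and NO import of the route file `Theses.BalabanUVNodes` anywhere (port-lead docket
O-8: the JOIN is keyed to LOCAL verbatim copies of the two signed texts, so a re-key of a route decl cannot break it).  [I] = [Balaban1987RG1], [15] = [Balaban1985Variational].

THIS FILE (JOIN §3 `l1_neg`, §4, §5, §9 `kappa₀_std_pos`, §11):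
* §4 ★ the chart rows of the slot text at the members `recordK₀ F Mc k + n`, BY NAME from the tree: `Chart44D` is ✓`K0PortChart44DAtRecord.chart44DJ_record` itself
  (`α₂ := min ¼ (min α₁ (α₀∕36))`; lens-1's one-line alias `chart44D_members` dropped as an identical-content duplicate), `chartEquivariant_members` (✓`BalabanUVNodesPortS1.chartEquivariantAtJ`), `noInvariantCovector_members` (✓`…noInvariantCovectorAtJ`),
  ★ `chart_cut` — the two-block chart of `X` reads its input only on `recordCXJ X`, for EVERY output coordinate.
* §5 ★ `limit121_members` — the (1.21) letter `PolLimitExists` ⟹ the slot text's `Limit121` along the members (✓`K0RecordFormatNames.tendsto_pvolOf`).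
* §9 `kappa₀_std_pos`.
* §11 ★★ `formatPlusG_chartSwap` — GENERIC: `FormatPlusG` at `ι₁` ∧ the LOCAL swap row «near `B = 0`, ∀ X, ∃ g, ∀ i ∈ coords X, χ_X (ι₂ B) i = (act g (χ_X (ι₁ B))) i»
  ⟹ `FormatPlusG` at `ι₂`, by the mould's OWN `Local17` + `GaugeInv119` (`g` ranges over ALL of `G n`); `swapRow_of_global ∕ swapRow_of_forall`; ★ `response9D_flipL`
  (⁷‴'s (C1) `Response9DAtL`, DEF-1 ed.14 BY NAME, transfers to `flipL`: only (R4ᴰ) reads `e`, under a `|·|`-symmetric window guard); ★ `rowG_flipL` (RowG for `flipL`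
  from the row at the names — in the tree ✓p801674 `PortHRecordRowG.rowG_slot8_at_names`; `l1 (−z) = l1 z`); ★ `chart_cut_members_L`.

HONEST FRAMING.  Bookkeeping ∕ calculus ∕ generic implications over DISPLAYED rows; every displayed row of the JOIN is the consequent of an OPEN signed statement item
(27930 ⁸ `PortRecordRepresentationS1` 12934e3fd231d69a; 27931 ⁷‴ `PortPieceLocalityU8` v9-L ce176c419bf63055) or a tree receipt; TokP9-reg ([15] Thm 1 + Prop. 9 AT THE
RECORD) is the texts' own antecedent and is NOT proved; nothing of [I] (Thm 1, (1.19)–(1.22), (4.33)–(4.37), (5.10)) or [15] (Thm 1, Prop. 9, (190)) is asserted, ported,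
discharged or refuted; K-Ax 27238∕27239∕27247 OPEN; K0⁷∕K0ᴬ OPEN; NODE O 0∕1; COUNT 8∕28 · K 1∕4 UNMOVED; ONE finite `𝕋⁴_{L^K}` at fixed ε — NOT continuum ∕ OS ∕ Clay;
**the Yang–Mills mass gap (Clay) is NOT proved by any of this.**  No `sorry`, no `instance`, no `notation`; standard axioms.
-/

noncomputable section

open scoped BigOperators Matrix.Norms.L2Operator Topology
open Set Filter

namespace Summit.QuantumFields.YangMills.Theorems.PortHRecordJoin

open Summit.QuantumFields.YangMills.Theorems.K0RecordFormatNames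
open Summit.QuantumFields.YangMills.Theorems
open Literature.MathematicalPhysics.QuantumFieldTheory.Balaban1983to89
open Literature.MathematicalPhysics.QuantumFieldTheory.Balaban1983to89.Node00
open Literature.MathematicalPhysics.QuantumFieldTheory.Balaban1983to89.T4Continuum (T4Family)
open NormedSpace (exp)

variable {F : T4Family}

/-! ## JOIN §3∕§4  `‖−z‖₁ = ‖z‖₁`; the chart rows of the slot text at the members, BY NAME from the tree -/

/-- `‖−z‖₁ = ‖z‖₁`. [folklore] -/
theorem l1_neg (z : Fin 4 → ℤ) : B12Sec2to5.l1 (-z) = B12Sec2to5.l1 z := by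
  simp [B12Sec2to5.l1, abs_neg]

/-- ★ `ChartEquivariant` at the members (tree `BalabanUVNodesPortS1.chartEquivariantAtJ`). [cite: Balaban1987RG1, (4.8) p.283, (1.10) p.262] -/
theorem chartEquivariant_members (Mc k K₀ : ℕ) :
    B12FormatPlus.ChartEquivariant (fun n => recordToG F (K₀ + n)) (fun n => recordAct F (K₀ + n))
      (fun n => recordChartJ F Mc k (K₀ + n)) (fun n => recordAdJ F (K₀ + n)) :=
  fun n X h u => BalabanUVNodesPortS1.chartEquivariantAtJ F Mc k (K₀ + n) X h u

/-- ★ `NoInvariantCovector` at the members (tree `BalabanUVNodesPortS1.noInvariantCovectorAtJ`). [cite: Balaban1987RG1, (4.13)–(4.14) p.284] -/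
theorem noInvariantCovector_members (K₀ : ℕ) : ∀ n, B12FormatPlus.NoInvariantCovector (recordAdJ F (K₀ + n)) :=
  fun n => BalabanUVNodesPortS1.noInvariantCovectorAtJ F (K₀ + n)

/-- ★ **Cut-locality of the two-block chart**: the chart of `X` reads its input only on the chart indices over the bonds of `X` (`recordCXJ`), so cutting the input to
them changes nothing — for EVERY output coordinate. [cite: Balaban1987RG1, (1.9) p.261, (4.35) p.290] -/
theorem chart_cut (Mc k K : ℕ) (X : (recordDomSys F Mc k K).Dom) (u : Fin (recordChartDimJ F K) → ℂ) :
    recordChartJ F Mc k K X (B12FormatPlus.cutTo (recordCXJ F Mc k K X) u) = recordChartJ F Mc k K X u := by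
  classical
  have hU : ∀ b ∈ domBonds F Mc k K X, chartMatU F K (B12FormatPlus.cutTo (recordCXJ F Mc k K X) u) b = chartMatU F K u b := by
    intro b hb
    unfold chartMatU
    refine Finset.sum_congr rfl fun a _ => ?_
    rw [B12FormatPlus.cutTo_apply, if_pos]
    simp [recordCXJ, hb]
  have hJ : ∀ b ∈ domBonds F Mc k K X, chartMatJc F K (B12FormatPlus.cutTo (recordCXJ F Mc k K X) u) b = chartMatJc F K u b := by
    intro b hb
    unfold chartMatJc
    refine Finset.sum_congr rfl fun a _ => ?_
    rw [B12FormatPlus.cutTo_apply, if_pos]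
    simp [recordCXJ, hb]
  unfold recordChartJ
  congr 1
  refine Prod.ext (funext fun b => ?_) (funext fun b => ?_)
  · by_cases hb : b ∈ domBonds F Mc k K X
    · simp only [if_pos hb, hU b hb]
    · simp only [if_neg hb]
  · by_cases hb : b ∈ domBonds F Mc k K X
    · simp only [if_pos hb, hJ b hb]
    · simp only [if_neg hb]

/-! ## JOIN §5  `Limit121` at the members from the (1.21) letter -/

section Generic
variable {𝔄 : Type*} [NormedRing 𝔄] [NormedAlgebra ℝ 𝔄]
variable {V : Type*} [NormedAddCommGroup V] [NormedSpace ℝ V] {ι : Type*} [Fintype ι]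
variable (fam : TermFamily1 F 𝔄) (ρ : V →L[ℝ] 𝔄) (bV : Module.Basis ι ℝ V)

/-- ★ **(1.21) letter ⟹ T-3′'s `Limit121` along the members `K₀ + n`.** [cite: Balaban1987RG1, (1.21) p.264] -/
theorem limit121_members (k : ℕ) (v : Fin (k + 1) → ℝ) (K₀ : ℕ) (h : PolLimitExists F (k + 1) (fun K => fam k v K) ρ bV) :
    B12FormatPlus.Limit121 (fun n => pvolOf F fam ρ bV k v (K₀ + n)) (plimOf F fam ρ bV k v) := by
  intro μ ν z
  have hK : Tendsto (fun n : ℕ => K₀ + n) atTop atTop :=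
    tendsto_atTop_atTop.2 fun b => ⟨b, fun n hn => hn.trans (Nat.le_add_left n K₀)⟩
  exact (tendsto_pvolOf F fam ρ bV k v h μ ν z).comp hK

end Generic

/-- `0 < kappa₀ (4·2⁴) (2·4)` (`kappa₀ c₀ Δ = c₀ · log (2(Δ+1)²)`). [folklore] -/
theorem kappa₀_std_pos : 0 < B12TreeDecay.kappa₀ (4 * 2 ^ 4) (2 * 4) := by
  unfold B12TreeDecay.kappa₀ B12TreeDecay.a₀
  refine mul_pos (by norm_num) (Real.log_pos ?_)
  push_cast
  norm_num

/-! ## §11  (v4 — Q-12 RULED ∕ №486 ∕ Q-12b X1′) ONE CHART THROUGHOUT.  ⁸ stays AS SIGNED at the rooted `recordEmbJ`; the slot text is read at an L-CHART `ιL`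
(ed.14 (L+)'s `recordEmbL`-to-be — a PARAMETER here, so that the instantiation is `rfl`s once the name lands); ⁸'s `Repr17` germ MOVES to `ιL` by ⁸'s OWN `GaugeInv119` row and
a chart-level SWAP ROW; the response rows read ed.14's `recordResponse9DataFromL` ∕ `Response9DAtL` BY NAME (tree, p-accepted 2026-08-31) -/

section ChartSwap

variable {S : ℕ → LocDomainSys} {M m : ℕ → ℕ} {G : ℕ → Type*}
  {act : (n : ℕ) → G n → (Fin (M n) → ℂ) → (Fin (M n) → ℂ)}
  {Uc : (n : ℕ) → (S n).Dom → Set (Fin (M n) → ℂ)} {coords : (n : ℕ) → (S n).Dom → Finset (Fin (M n))}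
  {χ : (n : ℕ) → (S n).Dom → (Fin (m n) → ℂ) → (Fin (M n) → ℂ)} {W : ℕ → Type*} [∀ n, TopologicalSpace (W n)] [∀ n, Zero (W n)]
  {Φf : (n : ℕ) → W n → ℂ} {ι₁ ι₂ : (n : ℕ) → W n → (Fin (m n) → ℂ)}
  {wrap : (n : ℕ) → Finset (S n).Dom} {emb : (n : ℕ) → (S n).Dom → (S (n + 1)).Dom}
  {πc : (n : ℕ) → (S n).Dom → (Fin (M (n + 1)) → ℂ) → (Fin (M n) → ℂ)} {E₀ κ : ℝ}

/-- ★★ **GENERIC CHART SWAP for typer-1's `FormatPlusG`.**  Of the six rows under the `∃ E`, ONLY `Repr17` reads the coordinate embedding `ι`; if a second embedding `ι₂`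
charts, near `B = 0` and for every domain `X`, a configuration that agrees ON THE COORDINATES «IN X» (`coords n X`, the (1.7) locality set) with an `act`-translate of the one `ι₁`
charts — the LOCAL SWAP ROW `∀ i ∈ coords X, χ_X (ι₂ B) i = (act g (χ_X (ι₁ B))) i`, `g` may depend on `n, B, X` — then the SAME pieces represent `Φf` through `ι₂`: by the mould's
OWN (1.7) row `Local17` and (1.19) row `GaugeInv119` («E(X, (𝐔,𝐉)^u) = E(X, 𝐔, 𝐉)» for ALL `Gᶜ`-valued `u`, residual or not).  LOCAL, NOT GLOBAL: a chart cut to `X` puts `(1, 0)` OFF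
`X`, where an `act`-translate puts `(u₋u₊⁻¹, 0)` — the global identity `χ_X (ι₂ B) = act g (χ_X (ι₁ B))` is FALSE for site-dependent `u`; only the restriction to `coords X` is asked.
So a port text delivering `FormatPlusG` at a ROOTED chart delivers it at ANY re-gauged chart of the same orbit. [cite: Balaban1987RG1, (1.19) p.263, (1.7) p.261, (1.10) p.262, p.258 («modulo a gauge transformation»)] -/
theorem formatPlusG_chartSwap
    (h : B12FormatPlus.FormatPlusG S M act Uc coords m χ Φf ι₁ wrap emb πc E₀ κ)
    (hsw : ∀ n, ∀ᶠ B in 𝓝 (0 : W n), ∀ X : (S n).Dom, ∃ g : G n, ∀ i ∈ coords n X, χ n X (ι₂ n B) i = act n g (χ n X (ι₁ n B)) i) :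
    B12FormatPlus.FormatPlusG S M act Uc coords m χ Φf ι₂ wrap emb πc E₀ κ := by
  obtain ⟨E, hA, hB, hL, hR, hV, hG⟩ := h
  refine ⟨E, hA, hB, hL, fun n => ?_, hV, hG⟩
  filter_upwards [hR n, hsw n] with B hB hs
  rw [hB]
  refine Finset.sum_congr rfl fun X _ => ?_
  obtain ⟨g, hg⟩ := hs X
  rw [hL n X _ _ hg, hG.2 n g X]

/-- The GLOBAL pointwise form implies the local swap row (recorded for completeness; at the record only the local form is satisfiable, see above).
[cite: Balaban1987RG1, (1.10) p.262 (bookkeeping)] -/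
theorem swapRow_of_global
    (hsw : ∀ n, ∀ᶠ B in 𝓝 (0 : W n), ∀ X : (S n).Dom, ∃ g : G n, χ n X (ι₂ n B) = act n g (χ n X (ι₁ n B))) :
    ∀ n, ∀ᶠ B in 𝓝 (0 : W n), ∀ X : (S n).Dom, ∃ g : G n, ∀ i ∈ coords n X, χ n X (ι₂ n B) i = act n g (χ n X (ι₁ n B)) i :=
  fun n => (hsw n).mono fun B hB X => (hB X).imp fun g hg i _ => by rw [hg]

/-- The local swap row from its EVERY-`B` form — the shape an explicit re-gauging `ι₂ B := coords((U_B)^{u(B)})` delivers. [cite: Balaban1987RG1, (1.10) p.262 (bookkeeping)] -/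
theorem swapRow_of_forall
    (hsw : ∀ n (B : W n) (X : (S n).Dom), ∃ g : G n, ∀ i ∈ coords n X, χ n X (ι₂ n B) i = act n g (χ n X (ι₁ n B)) i) :
    ∀ n, ∀ᶠ B in 𝓝 (0 : W n), ∀ X : (S n).Dom, ∃ g : G n, ∀ i ∈ coords n X, χ n X (ι₂ n B) i = act n g (χ n X (ι₁ n B)) i :=
  fun n => Filter.Eventually.of_forall fun B => hsw n B

end ChartSwap

/-! ## JOIN §11 (cont.)  ⁷‴'s (C1), RowG and cut-locality for `flipL` -/

/-- ★ **⁷‴'s (C1) `Response9DAtL` (ed.14, BY NAME) transfers to `flipL`** — as in §2, only (R4ᴰ) reads `e`, under a `|·|`-symmetric window guard.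
[cite: Balaban1985Variational, Prop. 9 p.309; Balaban1987RG1, (1.21) p.264, (4.4) p.281] -/
theorem response9D_flipL (θ : Stage13Params F 2) (a : θ.ιβ) (Mc k K₀ : ℕ) {α₂ C₉ δ₀ : ℝ}
    (h : Response9DAtL F θ a Mc k K₀ α₂ C₉ δ₀) :
    B12FormatPlus.Response9D (flipL F θ a Mc k K₀) (fun n => recordChartJ F Mc k (K₀ + n)) (fun n => recordRNat F Mc k (K₀ + n))
      (fun n X => recordDom44J F Mc k (K₀ + n) X α₂) C₉ δ₀ := by
  obtain ⟨h0, h1, hR1, hR3, hR4, hR5⟩ := h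
  refine ⟨h0, h1, hR1, hR3, fun n X hX μ z hz => ?_, hR5⟩
  have hz' : ∀ l, 2 * |(-z) l| < (recordRNat F Mc k (K₀ + n) : ℤ) := fun l => by simpa only [Pi.neg_apply, abs_neg] using hz l
  have h4 := hR4 n X hX μ (-z) hz'
  simp only [flipL_e]
  exact h4

/-- ★ RowG for `flipL` from the row at the names (GroupG v1.3 ★ `rowG_slot8_at_names`, as `hG`) — verbatim the §3 argument. [cite: Balaban1987RG1, (0.26) p.258, (1.21) p.264, (4.37) p.290] -/
theorem rowG_flipL (θ : Stage13Params F 2) (a : θ.ιβ) {Mc k : ℕ} {Mg c₁ κ' δ' K₀' K₁ : ℝ}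
    (hG : (∀ n, B12Decay510.GeomLeaf (recordSiteGeom F Mc k (recordK₀ F Mc k + n)) (recordRho F k (recordK₀ F Mc k + n)) Mg c₁ ∧
        B12Decay510.CubeSumLeaf (recordSiteGeom F Mc k (recordK₀ F Mc k + n)) δ' K₁ ∧
        B12Decay510.TreeLeaf (recordCc F Mc k (recordK₀ F Mc k + n)) κ' K₀') ∧
      ∀ (μ ν : Fin 4) (z : Fin 4 → ℤ), ∀ᶠ n in atTop,
        recordRho F k (recordK₀ F Mc k + n) (recordE F k (recordK₀ F Mc k + n) μ 0) (recordE F k (recordK₀ F Mc k + n) ν z) = B12Sec2to5.l1 z) :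
    (∀ n, B12Decay510.GeomLeaf ((flipL F θ a Mc k (recordK₀ F Mc k)).G n) ((flipL F θ a Mc k (recordK₀ F Mc k)).ρ n) Mg c₁ ∧
        B12Decay510.CubeSumLeaf ((flipL F θ a Mc k (recordK₀ F Mc k)).G n) δ' K₁ ∧
        B12Decay510.TreeLeaf ((flipL F θ a Mc k (recordK₀ F Mc k)).Cc n) κ' K₀') ∧
    ∀ (μ ν : Fin 4) (z : Fin 4 → ℤ), ∀ᶠ n in atTop,
      (flipL F θ a Mc k (recordK₀ F Mc k)).ρ n ((flipL F θ a Mc k (recordK₀ F Mc k)).e n μ 0)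
        ((flipL F θ a Mc k (recordK₀ F Mc k)).e n ν z) = B12Sec2to5.l1 z := by
  refine ⟨fun n => hG.1 n, fun μ ν z => (hG.2 μ ν (-z)).mono fun n hn => ?_⟩
  rw [flipL_e_zero, flipL_e, ← l1_neg z]
  exact hn

/-- ★ Cut-locality at the members for `flipL`'s `cX` (= `recordCXJ`, definitional), every `coords`. [cite: Balaban1987RG1, (4.35) p.290] -/
theorem chart_cut_members_L (θ : Stage13Params F 2) (a : θ.ιβ) (Mc k K₀ : ℕ)
    (coords : (n : ℕ) → (recordDomSys F Mc k (K₀ + n)).Dom → Finset (Fin (recordBondCount F (K₀ + n)))) :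
    ∀ n X u, ∀ i ∈ coords n X,
      recordChartJ F Mc k (K₀ + n) X (B12FormatPlus.cutTo ((flipL F θ a Mc k K₀).cX n X) u) i = recordChartJ F Mc k (K₀ + n) X u i := by
  intro n X u i _
  show recordChartJ F Mc k (K₀ + n) X (B12FormatPlus.cutTo (recordCXJ F Mc k (K₀ + n) X) u) i = _
  rw [chart_cut]

end Summit.QuantumFields.YangMills.Theorems.PortHRecordJoin

end
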